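import Mathlib
import Literature.MathematicalPhysics.StatisticalMechanics.LocalMatchingCompactness
import Literature.Geometry.DiscreteGeometry.KissingPatterns
import Summits.AtomisticToContinuum.Crystallization.Theorems.PhononSlackCertificatesPeriodicGivenLayeredExtraction2

/-!
# `CleanLimitsHaveWindows` (stmt-AtomisticToContinuum-15932), line `Sketch` — stub S1b:
# shell closeness passes to local limits

Support file for the skeleton of the crux `GappedShellCensus.CleanLimitsHaveWindows`: the stub
`stub_shellLimitClosed`. If `Z_k → Z` locally (two-way `ε`-matched on every ball about `0`,
eventually in `k`), every `Z_k` is everywhere clean at scale `a` (gapped-twelve shells,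
`1/5`-close after rescaling to the fcc or the hcp kissing pattern) and `Z` is already known to be
gapped-twelve at every site and `a(1 - 1/50)`-separated, then every rescaled bond shell of `Z`
is `1/5`-close to the fcc or the hcp kissing pattern.

Proof: fix `y ∈ Z` with shell `S` (twelve points). For a tolerance `ε ≤ a/100` and an index
`k` with `BallMatch ε (‖y‖ + 2a) 0 (Z_k) Z`, the point `y` is matched by `y' ∈ Z_k` and `S` is
matched injectively into the shell of `y'` (gap of `Z_k`); composing with the `1/5`-matching of
that shell with `A(P)` (`P` = fcc or hcp, `A` a linear isometry) gives an injection `σ` of `S`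
into `P` with `dist (a⁻¹(w_k - y'_k)) (A_k (σ_k w)) ≤ 1/5`. Along `ε_n → 0`: finitely many
`(P, σ)` (pigeonhole, `Filter.extraction_of_frequently_atTop`), compactness of `O(3)`
(`LayeredHull.ext_isCompact_isometries`), and the closed condition `≤ 1/5` passes to the
limit; counting (`12 = 12`) turns the injection into the required bijection.
-/

noncomputable section

namespace Summit.AtomisticToContinuum.Crystallization.Theorems.CleanHull

open Filter Topology Metric
open Literature.MathematicalPhysics.StatisticalMechanics
open Literature.Geometry.DiscreteGeometry

/-! ## One approximation step -/

/-- **One matching step.** Let `Zk` be everywhere clean at scale `a`, `Z ⊇ S` with `S` inside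
the closed `a(1 + 1/50)`-shell about `y ∈ Z` (and `y ∉ S`), `Z` `a(1 - 1/50)`-separated, and
`BallMatch ε (‖y‖ + 2a) 0 Zk Z` with `ε ≤ a/100`. Then there are a pattern `P` (fcc or hcp), a
linear isometry `A`, a point `y'` within `ε` of `y`, a matching `m` moving the points of `S` by
`≤ ε`, and an injection `σ` of `S` into `P` with `dist (a⁻¹ (m w - y')) (A (σ w)) ≤ 1/5` on
`S`. [folklore] -/
theorem shellLimit_one_step {a ε : ℝ} (ha : 0 < a) (hεa : ε ≤ a / 100)
    {Zk Z S : Set (EuclideanSpace ℝ (Fin 3))}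
    (hZk : ∀ y ∈ Zk, ({w ∈ Zk | w ≠ y ∧ dist y w ≤ a * (1 + 1 / 50)}.ncard = 12 ∧
        ∀ w ∈ Zk, w ≠ y → a * (1 - 1 / 50) ≤ dist y w ∧
          (dist y w ≤ a * (1 + 1 / 50) ∨ a * (63 / 50) ≤ dist y w)) ∧
      ∃ T : Finset (EuclideanSpace ℝ (Fin 3)), (↑T : Set (EuclideanSpace ℝ (Fin 3))) =
          (fun w => a⁻¹ • (w - y)) '' {w ∈ Zk | w ≠ y ∧ dist y w ≤ a * (1 + 1 / 50)} ∧
        (ShellCloseTo (1 / 5) T fccKissingPattern ∨ ShellCloseTo (1 / 5) T hcpKissingPattern))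
    {y : EuclideanSpace ℝ (Fin 3)} (hy : y ∈ Z)
    (hS : ∀ w ∈ S, w ∈ Z ∧ w ≠ y ∧ dist y w ≤ a * (1 + 1 / 50))
    (hsep : ∀ p ∈ Z, ∀ q ∈ Z, p ≠ q → a * (1 - 1 / 50) ≤ dist p q)
    (hBM : BallMatch ε (‖y‖ + 2 * a) 0 Zk Z) :
    ∃ (P : Finset (EuclideanSpace ℝ (Fin 3)))
      (A : EuclideanSpace ℝ (Fin 3) →ₗᵢ[ℝ] EuclideanSpace ℝ (Fin 3)) (y' : EuclideanSpace ℝ (Fin 3))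
      (m σ : EuclideanSpace ℝ (Fin 3) → EuclideanSpace ℝ (Fin 3)),
      (P = fccKissingPattern ∨ P = hcpKissingPattern) ∧ dist y' y ≤ ε ∧
        (∀ w ∈ S, dist (m w) w ≤ ε) ∧ Set.InjOn σ S ∧ (∀ w ∈ S, σ w ∈ P) ∧
        ∀ w ∈ S, dist (a⁻¹ • (m w - y')) (A (σ w)) ≤ 1 / 5 := by
  classical
  -- match `y`
  obtain ⟨y', hy'Zk, hy'y⟩ := hBM.1 y hy (by rw [dist_zero_right]; linarith)
  -- a matching function on `S`
  have hmatch : ∀ s : EuclideanSpace ℝ (Fin 3), ∃ a' : EuclideanSpace ℝ (Fin 3),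
      s ∈ S → a' ∈ Zk ∧ dist a' s ≤ ε := by
    intro s
    by_cases hs : s ∈ S
    · have hsR : dist s 0 ≤ ‖y‖ + 2 * a := by
        have h1 := dist_triangle s y (0 : EuclideanSpace ℝ (Fin 3))
        rw [dist_zero_right, dist_zero_right, dist_comm s y] at h1
        have h2 := (hS s hs).2.2
        rw [dist_zero_right]
        linarith
      obtain ⟨a', ha', hd⟩ := hBM.1 s (hS s hs).1 hsR
      exact ⟨a', fun _ => ⟨ha', hd⟩⟩
    · exact ⟨s, fun h => (hs h).elim⟩
  choose m hm using hmatch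
  -- the shell of `y'` in `Zk`
  obtain ⟨⟨-, hgap'⟩, T', hT', hclose⟩ := hZk y' hy'Zk
  -- `m` maps `S` into the shell of `y'`
  have hmS' : ∀ w ∈ S, m w ∈ {w ∈ Zk | w ≠ y' ∧ dist y' w ≤ a * (1 + 1 / 50)} := by
    intro w hw
    obtain ⟨hmw, hdw⟩ := hm w hw
    obtain ⟨hwZ, hwy, hwd⟩ := hS w hw
    have hyw : a * (1 - 1 / 50) ≤ dist y w := hsep y hy w hwZ (Ne.symm hwy)
    have hne : m w ≠ y' := by
      intro h
      have : dist y w ≤ dist y' y + dist (m w) w := by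
        calc dist y w ≤ dist y y' + dist y' w := dist_triangle _ _ _
          _ = dist y' y + dist (m w) w := by rw [dist_comm y y', h]
      linarith
    refine ⟨hmw, hne, ?_⟩
    have hup : dist y' (m w) ≤ ε + a * (1 + 1 / 50) + ε := by
      calc dist y' (m w) ≤ dist y' y + dist y w + dist w (m w) := dist_triangle4 _ _ _ _
        _ ≤ ε + a * (1 + 1 / 50) + ε := by
            rw [dist_comm w]
            exact add_le_add_three hy'y hwd hdw
    rcases (hgap' (m w) hmw hne).2 with h | h
    · exact h
    · exfalso
      linarith
  -- `m` is injective on `S`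
  have hminj : Set.InjOn m S := by
    intro w₁ hw₁ w₂ hw₂ heq
    by_contra hne
    have h1 := hsep w₁ (hS w₁ hw₁).1 w₂ (hS w₂ hw₂).1 hne
    have h2 : dist w₁ w₂ ≤ dist (m w₁) w₁ + dist (m w₂) w₂ := by
      calc dist w₁ w₂ ≤ dist w₁ (m w₁) + dist (m w₁) w₂ := dist_triangle _ _ _
        _ = dist (m w₁) w₁ + dist (m w₂) w₂ := by rw [dist_comm w₁, heq]
    linarith [(hm w₁ hw₁).2, (hm w₂ hw₂).2]
  -- the pattern and the matching of the shell of `y'`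
  obtain ⟨P, hP, A, e, he⟩ : ∃ P : Finset (EuclideanSpace ℝ (Fin 3)),
      (P = fccKissingPattern ∨ P = hcpKissingPattern) ∧ ShellCloseTo (1 / 5) T' P := by
    rcases hclose with h | h
    · exact ⟨_, Or.inl rfl, h⟩
    · exact ⟨_, Or.inr rfl, h⟩
  have hT'mem : ∀ w ∈ S, a⁻¹ • (m w - y') ∈ T' := by
    intro w hw
    rw [← Finset.mem_coe, hT']
    exact ⟨m w, hmS' w hw, rfl⟩
  -- pulling back through `A`
  have hun : ∀ q : ↥(P.image A), ∃ p ∈ P, A p = q.1 := fun q => Finset.mem_image.1 q.2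
  choose u hu huA using hun
  -- the injection `σ`
  obtain ⟨σ, hσ⟩ : ∃ σ : EuclideanSpace ℝ (Fin 3) → EuclideanSpace ℝ (Fin 3), ∀ w (hw : w ∈ S),
      σ w = u (e ⟨a⁻¹ • (m w - y'), hT'mem w hw⟩) :=
    ⟨fun w => if hw : w ∈ S then u (e ⟨a⁻¹ • (m w - y'), hT'mem w hw⟩) else 0,
      fun w hw => dif_pos hw⟩
  refine ⟨P, A, y', m, σ, hP, hy'y, fun w hw => (hm w hw).2, ?_, fun w hw => ?_, fun w hw => ?_⟩
  · -- injectivity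
    intro w₁ hw₁ w₂ hw₂ heq
    rw [hσ w₁ hw₁, hσ w₂ hw₂] at heq
    have h1 := congrArg A heq
    rw [huA, huA] at h1
    have h2 := e.injective (Subtype.ext h1)
    have h3 : a⁻¹ • (m w₁ - y') = a⁻¹ • (m w₂ - y') := congrArg Subtype.val h2
    have h4 : m w₁ = m w₂ :=
      sub_left_inj.1 (smul_right_injective (EuclideanSpace ℝ (Fin 3)) (inv_ne_zero ha.ne') h3)
    exact hminj hw₁ hw₂ h4
  · -- values in `P`
    rw [hσ w hw]
    exact hu _
  · -- closeness
    rw [hσ w hw, huA]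
    exact he ⟨_, hT'mem w hw⟩

/-! ## From an injection into the pattern to `ShellCloseTo` -/

/-- **Counting.** If `S` (twelve points) injects into a twelve-point pattern `P` by `σ` with
`dist (a⁻¹ (w - y)) (A (σ w)) ≤ η` on `S`, then the rescaled shell `{a⁻¹ (w - y) : w ∈ S}` is
`η`-matched to `A(P)` (an injection between sets of the same finite size is a bijection).
[folklore] -/
theorem shellLimit_shellCloseTo_of_injOn {η a : ℝ} (ha : a ≠ 0) {y : EuclideanSpace ℝ (Fin 3)}
    {S : Set (EuclideanSpace ℝ (Fin 3))} (hS : S.Finite) (hS12 : S.ncard = 12)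
    {P : Finset (EuclideanSpace ℝ (Fin 3))} (hP : P.card = 12)
    (A : EuclideanSpace ℝ (Fin 3) →ₗᵢ[ℝ] EuclideanSpace ℝ (Fin 3))
    (σ : EuclideanSpace ℝ (Fin 3) → EuclideanSpace ℝ (Fin 3)) (hinj : Set.InjOn σ S)
    (hmaps : ∀ w ∈ S, σ w ∈ P) (hd : ∀ w ∈ S, dist (a⁻¹ • (w - y)) (A (σ w)) ≤ η) :
    ShellCloseTo η (hS.toFinset.image fun w => a⁻¹ • (w - y)) P := by
  classical
  -- the inverse of the rescaling
  have hback : ∀ t ∈ hS.toFinset.image (fun w => a⁻¹ • (w - y)),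
      y + a • t ∈ S ∧ a⁻¹ • ((y + a • t) - y) = t := by
    intro t ht
    simp only [Finset.mem_image, Set.Finite.mem_toFinset] at ht
    obtain ⟨w, hw, rfl⟩ := ht
    have h1 : y + a • a⁻¹ • (w - y) = w := by
      rw [smul_smul, mul_inv_cancel₀ ha, one_smul]
      abel
    rw [h1]
    exact ⟨hw, rfl⟩
  have hf_inj : Function.Injective fun w : EuclideanSpace ℝ (Fin 3) => a⁻¹ • (w - y) :=
    fun w₁ w₂ h =>
      sub_left_inj.1 (smul_right_injective (EuclideanSpace ℝ (Fin 3)) (inv_ne_zero ha) h)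
  have hcardT : (hS.toFinset.image fun w => a⁻¹ • (w - y)).card = 12 := by
    rw [Finset.card_image_of_injective _ hf_inj, ← Set.ncard_eq_toFinset_card S hS, hS12]
  obtain ⟨g, hg⟩ : ∃ g : ↥(hS.toFinset.image fun w => a⁻¹ • (w - y)) → ↥(P.image A),
      ∀ t, (g t).1 = A (σ (y + a • t.1)) :=
    ⟨fun t => ⟨A (σ (y + a • t.1)), Finset.mem_image_of_mem A (hmaps _ (hback _ t.2).1)⟩,
      fun t => rfl⟩
  have hg_inj : Function.Injective g := by
    intro t₁ t₂ h
    have h1 : A (σ (y + a • t₁.1)) = A (σ (y + a • t₂.1)) := by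
      rw [← hg, ← hg, h]
    have h2 := hinj (hback _ t₁.2).1 (hback _ t₂.2).1 (A.injective h1)
    have h3 : a • t₁.1 = a • t₂.1 := add_left_cancel h2
    exact Subtype.ext (smul_right_injective (EuclideanSpace ℝ (Fin 3)) ha h3)
  have hcard : Fintype.card ↥(hS.toFinset.image fun w => a⁻¹ • (w - y)) =
      Fintype.card ↥(P.image A) := by
    rw [Fintype.card_coe, Fintype.card_coe, hcardT,
      Finset.card_image_of_injective _ A.injective, hP]
  have hg_bij : Function.Bijective g :=
    (Fintype.bijective_iff_injective_and_card g).2 ⟨hg_inj, hcard⟩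
  refine ⟨A, Equiv.ofBijective g hg_bij, fun t => ?_⟩
  rw [Equiv.ofBijective_apply, hg]
  have := hd _ (hback _ t.2).1
  rwa [(hback _ t.2).2] at this

/-! ## The stub -/

/-- **Stub S1b (shell closeness passes to local limits).** In the situation of S1a, with `Z_k`
everywhere clean and `Z` already known to be gapped-twelve everywhere, every rescaled bond shell
of `Z` is `1/5`-close to the fcc or the hcp kissing pattern (finitely many bijection types,
compactness of `O(3)`, closed condition `≤ 1/5`). [folklore] -/
theorem stub_shellLimitClosed (a : ℝ) (ha : 0 < a) (Zs : ℕ → Set (EuclideanSpace ℝ (Fin 3)))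
    (Z : Set (EuclideanSpace ℝ (Fin 3)))
    (hZs : ∀ k, ∀ y ∈ Zs k, ({w ∈ Zs k | w ≠ y ∧ dist y w ≤ a * (1 + 1 / 50)}.ncard = 12 ∧
        ∀ w ∈ Zs k, w ≠ y → a * (1 - 1 / 50) ≤ dist y w ∧
          (dist y w ≤ a * (1 + 1 / 50) ∨ a * (63 / 50) ≤ dist y w)) ∧
      ∃ T : Finset (EuclideanSpace ℝ (Fin 3)), (↑T : Set (EuclideanSpace ℝ (Fin 3))) =
          (fun w => a⁻¹ • (w - y)) '' {w ∈ Zs k | w ≠ y ∧ dist y w ≤ a * (1 + 1 / 50)} ∧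
        (ShellCloseTo (1 / 5) T fccKissingPattern ∨ ShellCloseTo (1 / 5) T hcpKissingPattern))
    (hZ : ∀ y ∈ Z, {w ∈ Z | w ≠ y ∧ dist y w ≤ a * (1 + 1 / 50)}.ncard = 12 ∧
        ∀ w ∈ Z, w ≠ y → a * (1 - 1 / 50) ≤ dist y w ∧
          (dist y w ≤ a * (1 + 1 / 50) ∨ a * (63 / 50) ≤ dist y w))
    (hsep : ∀ p ∈ Z, ∀ q ∈ Z, p ≠ q → a * (1 - 1 / 50) ≤ dist p q)
    (hlim : ∀ R ε : ℝ, 0 < ε → ∀ᶠ k in Filter.atTop, BallMatch ε R 0 (Zs k) Z) :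
    ∀ y ∈ Z, ∃ T : Finset (EuclideanSpace ℝ (Fin 3)), (↑T : Set (EuclideanSpace ℝ (Fin 3))) =
        (fun w => a⁻¹ • (w - y)) '' {w ∈ Z | w ≠ y ∧ dist y w ≤ a * (1 + 1 / 50)} ∧
      (ShellCloseTo (1 / 5) T fccKissingPattern ∨ ShellCloseTo (1 / 5) T hcpKissingPattern) := by
  intro y hy
  have hS12 := (hZ y hy).1
  obtain ⟨S, hS_eq⟩ : ∃ S : Set (EuclideanSpace ℝ (Fin 3)),
      S = {w ∈ Z | w ≠ y ∧ dist y w ≤ a * (1 + 1 / 50)} := ⟨_, rfl⟩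
  rw [← hS_eq] at hS12 ⊢
  have hSmem : ∀ w ∈ S, w ∈ Z ∧ w ≠ y ∧ dist y w ≤ a * (1 + 1 / 50) := fun w hw => by
    rw [hS_eq] at hw
    exact hw
  have hSfin : S.Finite := Set.finite_of_ncard_pos (by rw [hS12]; norm_num)
  refine ⟨hSfin.toFinset.image fun w => a⁻¹ • (w - y),
    by rw [Finset.coe_image, Set.Finite.coe_toFinset], ?_⟩
  -- tolerances `ε n → 0`, `0 < ε n ≤ a / 100`
  obtain ⟨ε, hεpos, hεle, hεlim⟩ : ∃ ε : ℕ → ℝ, (∀ n, 0 < ε n) ∧ (∀ n, ε n ≤ a / 100) ∧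
      Tendsto ε atTop (𝓝 0) := by
    refine ⟨fun n => a / 100 * (1 / ((n : ℝ) + 1)), fun n => by positivity, fun n => ?_, ?_⟩
    · have hn : (0 : ℝ) ≤ n := Nat.cast_nonneg n
      refine mul_le_of_le_one_right (by positivity) ?_
      rw [div_le_one (by linarith)]
      linarith
    · simpa using (tendsto_one_div_add_atTop_nhds_zero_nat (𝕜 := ℝ)).const_mul (a / 100)
  -- indices `k n` with `BallMatch (ε n) (‖y‖ + 2a) 0 (Zs (k n)) Z`
  have hk : ∀ n, ∃ k, BallMatch (ε n) (‖y‖ + 2 * a) 0 (Zs k) Z := fun n =>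
    (hlim _ _ (hεpos n)).exists
  choose k hk using hk
  choose P A y' m σ hP hy' hm hinj hmaps hdist using fun n =>
    shellLimit_one_step ha (hεle n) (hZs (k n)) hy hSmem hsep (hk n)
  -- pigeonhole on the pattern and the restriction of `σ n` to `S`
  haveI : Finite ↥S := hSfin.to_subtype
  obtain ⟨V, hVfin, hvV⟩ : ∃ V : Set (Finset (EuclideanSpace ℝ (Fin 3)) ×
      (↥S → EuclideanSpace ℝ (Fin 3))), V.Finite ∧ ∀ n, (P n, S.restrict (σ n)) ∈ V := by
    refine ⟨({fccKissingPattern, hcpKissingPattern} : Set (Finset (EuclideanSpace ℝ (Fin 3)))) ×ˢ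
        Set.pi Set.univ (fun _ : ↥S => ((↑fccKissingPattern : Set (EuclideanSpace ℝ (Fin 3))) ∪
          (↑hcpKissingPattern : Set (EuclideanSpace ℝ (Fin 3))))),
      ((Set.finite_singleton _).insert _).prod
        (Set.Finite.pi fun _ => (Finset.finite_toSet _).union (Finset.finite_toSet _)),
      fun n => Set.mk_mem_prod ?_ (Set.mem_univ_pi.2 fun w => ?_)⟩
    · rcases hP n with h | h
      · rw [h]
        exact Set.mem_insert _ _
      · rw [h]
        exact Set.mem_insert_of_mem _ (Set.mem_singleton _)
    · have hw := hmaps n w w.2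
      rcases hP n with h | h
      · rw [h] at hw
        exact Or.inl hw
      · rw [h] at hw
        exact Or.inr hw
  have hfreq : ∃ v₀ ∈ V, ∃ᶠ n in atTop, (P n, S.restrict (σ n)) = v₀ := by
    by_contra hcon
    have hcon' : ∀ v₀ ∈ V, ∀ᶠ n in atTop, ¬(P n, S.restrict (σ n)) = v₀ := fun v₀ hv₀ =>
      Filter.not_frequently.1 fun hfr => hcon ⟨v₀, hv₀, hfr⟩
    obtain ⟨n, hn⟩ := (hVfin.eventually_all.2 hcon').exists
    exact hn _ (hvV n) rfl
  obtain ⟨⟨P₀, ρ⟩, hv₀, hfreq⟩ := hfreq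
  obtain ⟨φ, hφ, hφv⟩ := extraction_of_frequently_atTop hfreq
  have hPφ : ∀ n, P (φ n) = P₀ := fun n => (Prod.mk.inj (hφv n)).1
  have hσφ : ∀ n, ∀ w (hw : w ∈ S), σ (φ n) w = ρ ⟨w, hw⟩ := fun n w hw =>
    congrFun (Prod.mk.inj (hφv n)).2 ⟨w, hw⟩
  have hP₀ : P₀ = fccKissingPattern ∨ P₀ = hcpKissingPattern := by
    rcases hP (φ 0) with h | h
    · exact Or.inl ((hPφ 0).symm.trans h)
    · exact Or.inr ((hPφ 0).symm.trans h)
  -- compactness of `O(3)`: a convergent subsequence of the isometries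
  obtain ⟨L, hLK, ψ, hψ, hL⟩ := LayeredHull.ext_isCompact_isometries.tendsto_subseq
      (x := fun n => (A (φ n)).toContinuousLinearMap) fun n => by
        show ∀ v, ‖(A (φ n)).toContinuousLinearMap v‖ = ‖v‖
        intro v
        simp
  have hLK' : ∀ v, ‖L v‖ = ‖v‖ := hLK
  let A₀ : EuclideanSpace ℝ (Fin 3) →ₗᵢ[ℝ] EuclideanSpace ℝ (Fin 3) :=
    { toLinearMap := (L : EuclideanSpace ℝ (Fin 3) →ₗ[ℝ] EuclideanSpace ℝ (Fin 3))
      norm_map' := hLK' }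
  have hA₀ : ∀ p, A₀ p = L p := fun p => rfl
  -- limits along `φ ∘ ψ`
  have hθ : Tendsto (fun n => φ (ψ n)) atTop atTop := (hφ.comp hψ).tendsto_atTop
  have hεθ : Tendsto (fun n => ε (φ (ψ n))) atTop (𝓝 0) := hεlim.comp hθ
  have hyθ : Tendsto (fun n => y' (φ (ψ n))) atTop (𝓝 y) :=
    tendsto_iff_dist_tendsto_zero.2
      (squeeze_zero (fun n => dist_nonneg) (fun n => hy' (φ (ψ n))) hεθ)
  have hkey : ∀ w (hw : w ∈ S), dist (a⁻¹ • (w - y)) (L (ρ ⟨w, hw⟩)) ≤ 1 / 5 := by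
    intro w hw
    have hmθ : Tendsto (fun n => m (φ (ψ n)) w) atTop (𝓝 w) :=
      tendsto_iff_dist_tendsto_zero.2
        (squeeze_zero (fun n => dist_nonneg) (fun n => hm (φ (ψ n)) w hw) hεθ)
    have hAθ : Tendsto (fun n => A (φ (ψ n)) (ρ ⟨w, hw⟩)) atTop (𝓝 (L (ρ ⟨w, hw⟩))) := by
      have := ((continuous_eval_const
        (F := EuclideanSpace ℝ (Fin 3) →L[ℝ] EuclideanSpace ℝ (Fin 3)) (ρ ⟨w, hw⟩)).tendsto
          L).comp hL
      simpa [Function.comp_def] using this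
    have hT := ((hmθ.sub hyθ).const_smul a⁻¹).dist hAθ
    refine le_of_tendsto' hT fun n => ?_
    have := hdist (φ (ψ n)) w hw
    rwa [hσφ (ψ n) w hw] at this
  -- conclusion: the injection `σ (φ 0)` of `S` into `P₀` and the limit isometry `A₀`
  have hd₀ : ∀ w ∈ S, dist (a⁻¹ • (w - y)) (A₀ (σ (φ 0) w)) ≤ 1 / 5 := fun w hw => by
    rw [hσφ 0 w hw, hA₀]
    exact hkey w hw
  rcases hP₀ with rfl | rfl
  · exact Or.inl (shellLimit_shellCloseTo_of_injOn ha.ne' hSfin hS12 card_fccKissingPattern A₀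
      (σ (φ 0)) (hinj (φ 0)) (fun w hw => hPφ 0 ▸ hmaps (φ 0) w hw) hd₀)
  · exact Or.inr (shellLimit_shellCloseTo_of_injOn ha.ne' hSfin hS12 card_hcpKissingPattern A₀
      (σ (φ 0)) (hinj (φ 0)) (fun w hw => hPφ 0 ▸ hmaps (φ 0) w hw) hd₀)

end Summit.AtomisticToContinuum.Crystallization.Theorems.CleanHull

end
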